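import Literature.ComputerArithmetic.Shewchuk1997.Compress
import Mathlib.NumberTheory.Padics.PadicVal.Basic
import Mathlib.Tactic.Linarith
import Mathlib.Tactic.Positivity
import Mathlib.Tactic.Ring
import Mathlib.Tactic.NormNum

/-!
# The 2-adic valuation of floating-point numbers, and absorption by a full-odd float (new work)

New work of the certified-arithmetic venture (ENGINES group: shared numerical engines serving
client cells; rigour lives in the verifiers; every published number belongs to a client cell's
ledger, not to the engines group): the toolkit for the TERMINATION of iterated COMPRESS
[Shewchuk1997, §2.7] proved in `CompressValuationSteps.lean`, `CompressValuationDown.lean`,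
`CompressValuationUp.lean`, `CompressTerminates.lean`.  The potential that strictly decreases at
every active FAST-TWO-SUM step of COMPRESS is the sum of the 2-ADIC VALUATIONS of the components;
this file links Mathlib's `padicValRat 2` with the tree's grids `OnGrid s x` (`x ∈ 2^s·ℤ`,
[Shewchuk1997, §2.1 footnote 2]): for a nonzero `x` on some grid, `padicValRat 2 x` is the LARGEST
`s` with `x ∈ 2^s·ℤ` (`le_padicValRat_two_of_onGrid`, `onGrid_padicValRat_two`), so that
`2^(padicValRat 2 x) ≤ |x|`; the ultrametric rule for sums; the pinning of an odd multiple of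
`2^m` below `2^(m+1)`; and the ABSORPTION LEMMA: a float `g` whose significand is FULL AND ODD
(`ulp g = 2^k`, `g ∉ 2^(k+1)·ℤ`) absorbs every perturbation smaller than `ulp(g)/2` under any
round-to-nearest (`fl_eq_of_fullOdd`, `fastTwoSum_eq_of_fullOdd`) — because such a `g` is at least
`(2^(p−1)+1)·2^k` in magnitude (or `k = emin`), so `ulp` does not drop next to it.

References: J. R. Shewchuk, Discrete Comput. Geom. 18 (1997) 305–363, §2.7 [Shewchuk1997]; ulp
and roundings as in Boldo–Jeannerod–Melquiond–Muller, Acta Numerica 32 (2023), §2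
[BoldoEtAl2023].
-/

namespace Summit.Ventures.CertifiedArithmetic.Expansions

open Literature.ComputerArithmetic.JeannerodRump2018
open Literature.ComputerArithmetic.BoldoJeannerodMelquiondMuller2023 hiding twoSum twoSum_fst
open Literature.ComputerArithmetic.Shewchuk1997

variable {p : ℕ} {emin : ℤ} {fl : ℚ → ℚ}

/-! ### `padicValRat 2` versus grids -/

/-- The valuation of `r · 2^s` (`r` a nonzero integer) is `padicValInt 2 r + s`. -/
theorem padicValRat_two_int_mul_zpow {r : ℤ} (hr : r ≠ 0) (s : ℤ) :
    padicValRat 2 ((r : ℚ) * (2 : ℚ) ^ s) = (padicValInt 2 r : ℤ) + s := by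
  have hr' : (r : ℚ) ≠ 0 := Int.cast_ne_zero.mpr hr
  have h2 : padicValRat 2 (2 : ℚ) = 1 := by exact_mod_cast padicValRat.self (p := 2) one_lt_two
  rw [padicValRat.mul hr' (zpow_ne_zero s (by norm_num)), padicValRat.zpow, h2, mul_one,
    padicValRat.of_int]

/-- A nonzero element of `2^s·ℤ` has valuation at least `s`. -/
theorem le_padicValRat_two_of_onGrid {s : ℤ} {x : ℚ} (h : OnGrid s x) (hx : x ≠ 0) :
    s ≤ padicValRat 2 x := by
  obtain ⟨r, rfl⟩ := h
  have hr : r ≠ 0 := by rintro rfl; simp at hx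
  rw [padicValRat_two_int_mul_zpow hr]
  have : (0 : ℤ) ≤ (padicValInt 2 r : ℤ) := Int.natCast_nonneg _
  omega

/-- A nonzero dyadic rational lies on the grid of its valuation. -/
theorem onGrid_padicValRat_two {e : ℤ} {x : ℚ} (h : OnGrid e x) (hx : x ≠ 0) :
    OnGrid (padicValRat 2 x) x := by
  obtain ⟨r, rfl⟩ := h
  have hr : r ≠ 0 := by rintro rfl; simp at hx
  obtain ⟨r', hr'⟩ := padicValInt_dvd (p := 2) r
  refine ⟨r', ?_⟩
  rw [padicValRat_two_int_mul_zpow hr, zpow_add₀ (by norm_num : (2 : ℚ) ≠ 0), zpow_natCast]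
  conv_lhs => rw [hr']
  push_cast; ring

/-- `2^(valuation) ≤ |x|` for a nonzero dyadic `x`. -/
theorem two_zpow_padicValRat_two_le_abs {e : ℤ} {x : ℚ} (h : OnGrid e x) (hx : x ≠ 0) :
    (2 : ℚ) ^ (padicValRat 2 x) ≤ |x| :=
  (onGrid_padicValRat_two h hx).two_zpow_le_abs hx

/-- A nonzero dyadic of magnitude `< 2^s` has valuation `< s`. -/
theorem padicValRat_two_lt_of_abs_lt {e s : ℤ} {x : ℚ} (h : OnGrid e x) (hx : x ≠ 0)
    (hs : |x| < (2 : ℚ) ^ s) : padicValRat 2 x < s :=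
  (zpow_lt_zpow_iff_right₀ (by norm_num : (1 : ℚ) < 2)).mp
    ((two_zpow_padicValRat_two_le_abs h hx).trans_lt hs)

/-- A nonzero dyadic of magnitude `≤ 2^s` has valuation `≤ s`. -/
theorem padicValRat_two_le_of_abs_le {e s : ℤ} {x : ℚ} (h : OnGrid e x) (hx : x ≠ 0)
    (hs : |x| ≤ (2 : ℚ) ^ s) : padicValRat 2 x ≤ s :=
  (zpow_le_zpow_iff_right₀ (by norm_num : (1 : ℚ) < 2)).mp
    ((two_zpow_padicValRat_two_le_abs h hx).trans hs)

/-- A nonzero number is not on any grid coarser than its valuation. -/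
theorem not_onGrid_of_padicValRat_two_lt {s : ℤ} {x : ℚ} (hx : x ≠ 0)
    (hs : padicValRat 2 x < s) : ¬ OnGrid s x := fun h =>
  absurd (le_padicValRat_two_of_onGrid h hx) (not_le.mpr hs)

/-- A nonzero float has valuation `≥ emin`. -/
theorem emin_le_padicValRat_two {x : ℚ} (hx : IsFloat p emin x) (hx0 : x ≠ 0) :
    emin ≤ padicValRat 2 x :=
  le_padicValRat_two_of_onGrid (OnGrid.of_isFloat hx) hx0

/-- ULTRAMETRIC RULE: the valuation of a sum is that of the summand of smaller valuation. -/
theorem padicValRat_two_add_eq_left {a b : ℚ} (ha : a ≠ 0) (hb : b ≠ 0)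
    (h : padicValRat 2 a < padicValRat 2 b) : padicValRat 2 (a + b) = padicValRat 2 a := by
  have hab : a + b ≠ 0 := by
    intro h0
    have : b = -a := by linarith
    rw [this, padicValRat.neg] at h
    exact lt_irrefl _ h
  exact padicValRat.add_eq_of_lt hab ha hb h

/-- ULTRAMETRIC RULE, contrapositive form: if `a − d` has LARGER valuation than `a` then `d` has
the valuation of `a` (`a`, `d` nonzero). -/
theorem padicValRat_two_eq_of_lt_sub {a d : ℚ} (ha : a ≠ 0) (hd : d ≠ 0)
    (h : padicValRat 2 a < padicValRat 2 (a - d)) : padicValRat 2 d = padicValRat 2 a := by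
  by_contra hne
  rcases lt_or_gt_of_ne hne with hlt | hgt
  · have := padicValRat_two_add_eq_left (neg_ne_zero.mpr hd) ha (by rwa [padicValRat.neg])
    rw [neg_add_eq_sub, padicValRat.neg] at this
    omega
  · have := padicValRat_two_add_eq_left ha (neg_ne_zero.mpr hd) (by rwa [padicValRat.neg])
    rw [← sub_eq_add_neg] at this
    omega

/-! ### Grid arithmetic -/

/-- On the grid `2^a`, a strict bound `|y| < 2^m` (`a ≤ m`) improves to `|y| ≤ 2^m − 2^a`. -/
theorem abs_le_two_zpow_sub_of_onGrid {a m : ℤ} {y : ℚ} (hy : OnGrid a y) (ham : a ≤ m)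
    (hlt : |y| < (2 : ℚ) ^ m) : |y| ≤ (2 : ℚ) ^ m - (2 : ℚ) ^ a := by
  obtain ⟨r, rfl⟩ := hy
  obtain ⟨d, hd⟩ := Int.eq_ofNat_of_zero_le (by omega : 0 ≤ m - a)
  have h2a : (0 : ℚ) < (2 : ℚ) ^ a := zpow_pos (by norm_num) a
  have hsplit : (2 : ℚ) ^ m = (2 : ℚ) ^ d * (2 : ℚ) ^ a := by
    rw [show m = (d : ℤ) + a by omega, zpow_add₀ (by norm_num : (2 : ℚ) ≠ 0), zpow_natCast]
  rw [abs_mul, abs_of_pos h2a] at hlt ⊢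
  rw [hsplit] at hlt ⊢
  have hr : |(r : ℚ)| < (2 : ℚ) ^ d := lt_of_mul_lt_mul_right hlt h2a.le
  have hr' : |r| < 2 ^ d := by
    have : ((|r| : ℤ) : ℚ) < ((2 ^ d : ℤ) : ℚ) := by push_cast; exact hr
    exact_mod_cast this
  have hrle : (|(r : ℚ)|) ≤ (2 : ℚ) ^ d - 1 := by
    have : ((|r| : ℤ) : ℚ) ≤ ((2 ^ d - 1 : ℤ) : ℚ) := by
      exact_mod_cast (show |r| ≤ 2 ^ d - 1 by omega)
    push_cast at this; exact this
  nlinarith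

/-- An element of `2^s·ℤ` of magnitude `< 2^s` vanishes.
[cite: Shewchuk1997, §2.1 footnote 2] -/
theorem eq_zero_of_onGrid_of_abs_lt_two_zpow {s : ℤ} {x : ℚ} (hx : OnGrid s x)
    (hlt : |x| < (2 : ℚ) ^ s) : x = 0 := by
  by_contra h0
  exact absurd (hx.two_zpow_le_abs h0) (not_le.mpr hlt)

/-- PINNING: a nonzero `z ∈ 2^m·ℤ ∖ 2^(m+1)·ℤ` with `|z| ≤ 2^(m+1)` has `|z| = 2^m`. -/
theorem abs_eq_two_zpow_of_odd_multiple {m : ℤ} {z : ℚ} (hz : OnGrid m z)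
    (hz1 : ¬ OnGrid (m + 1) z) (hle : |z| ≤ (2 : ℚ) ^ (m + 1)) : |z| = (2 : ℚ) ^ m := by
  obtain ⟨r, rfl⟩ := hz
  have h2m : (0 : ℚ) < (2 : ℚ) ^ m := zpow_pos (by norm_num) m
  rw [abs_mul, abs_of_pos h2m] at hle ⊢
  rw [zpow_add_one₀ (by norm_num : (2 : ℚ) ≠ 0)] at hle
  have hr2 : |(r : ℚ)| ≤ 2 := by nlinarith
  have hr2' : |r| ≤ 2 := by
    have : ((|r| : ℤ) : ℚ) ≤ ((2 : ℤ) : ℚ) := by push_cast; exact hr2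
    exact_mod_cast this
  have hodd : ¬ (2 : ℤ) ∣ r := by
    rintro ⟨r', rfl⟩
    exact hz1 ⟨r', by rw [zpow_add_one₀ (by norm_num : (2 : ℚ) ≠ 0)]; push_cast; ring⟩
  have hr1 : |r| = 1 := by
    rcases (abs_le.mp hr2') with ⟨h1, h2⟩
    interval_cases r <;> simp_all
  have : |(r : ℚ)| = 1 := by rw [← Int.cast_abs, hr1]; simp
  rw [this, one_mul]

/-! ### Absorption by a full-odd float -/

/-- A float with FULL ODD significand (`ulp g = 2^k`, `g ∉ 2^(k+1)·ℤ`) keeps the ulp from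
dropping next to it: `|t − g| < 2^k/2 ⟹ ulp g ≤ ulp t` (`g` is not a power of two: if `k > emin`
then `|g| ≥ (2^(p−1) + 1)·2^k`, so `|t| ≥ 2^(k+p−1)`). [cite: BoldoEtAl2023, §2.1 Def. 2.4] -/
theorem ulp_le_ulp_of_fullOdd (hp : 2 ≤ p) {g t : ℚ} (hg : IsFloat p emin g)
    {k : ℤ} (hk : ulp p emin g = (2 : ℚ) ^ k) (hodd : ¬ OnGrid (k + 1) g)
    (ht : |t - g| < (2 : ℚ) ^ k / 2) : ulp p emin g ≤ ulp p emin t := by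
  have h2 : (0 : ℚ) < 2 := by norm_num
  obtain ⟨k', hk'e, hk'⟩ := exists_ulp_eq_two_zpow (p := p) (emin := emin) g
  have hkk : k' = k := by
    have := hk'.symm.trans hk
    exact zpow_right_injective₀ h2 (by norm_num) this
  subst hkk
  rcases hk'e.lt_or_eq with hlt | heq
  · -- normal case: `|g| ≥ 2^(k'+p-1)`
    have hglow : (2 : ℚ) ^ (k' + p - 1) ≤ |g| := two_zpow_le_abs_of_ulp_eq hk' hlt
    -- `g = r·2^k'` with `r` odd and `|r| ≥ 2^(p-1)`, hence `|r| ≥ 2^(p-1) + 1`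
    have hkg : OnGrid k' g := onGrid_of_two_zpow_le_ulp hg (by rw [hk'])
    obtain ⟨r, hr⟩ := hkg
    have hrodd : ¬ (2 : ℤ) ∣ r := by
      rintro ⟨r', rfl⟩
      exact hodd ⟨r', by
        rw [hr, zpow_add_one₀ (by norm_num : (2 : ℚ) ≠ 0)]; push_cast; ring⟩
    have h2k : (0 : ℚ) < (2 : ℚ) ^ k' := zpow_pos h2 k'
    have hrabs : (2 : ℚ) ^ (p - 1 : ℕ) ≤ |(r : ℚ)| := by
      have h1 : (2 : ℚ) ^ (k' + p - 1) = (2 : ℚ) ^ (p - 1 : ℕ) * (2 : ℚ) ^ k' := by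
        rw [← zpow_natCast, ← zpow_add₀ (by norm_num : (2 : ℚ) ≠ 0)]
        congr 1; push_cast [Nat.cast_sub (by omega : 1 ≤ p)]; ring
      rw [hr, abs_mul, abs_of_pos h2k, h1] at hglow
      exact le_of_mul_le_mul_right hglow h2k
    have hrabs' : (2 : ℤ) ^ (p - 1) ≤ |r| := by
      have : (((2 : ℤ) ^ (p - 1) : ℤ) : ℚ) ≤ ((|r| : ℤ) : ℚ) := by
        push_cast; exact hrabs
      exact_mod_cast this
    have hne : |r| ≠ (2 : ℤ) ^ (p - 1) := by
      intro h
      have hdvd : (2 : ℤ) ∣ (2 : ℤ) ^ (p - 1) := dvd_pow_self 2 (by omega)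
      rw [← h, dvd_abs] at hdvd
      exact hrodd hdvd
    have hr1 : (2 : ℤ) ^ (p - 1) + 1 ≤ |r| := by omega
    have hr1' : (2 : ℚ) ^ (p - 1 : ℕ) + 1 ≤ |(r : ℚ)| := by
      have : (((2 : ℤ) ^ (p - 1) + 1 : ℤ) : ℚ) ≤ ((|r| : ℤ) : ℚ) := by
        exact_mod_cast hr1
      push_cast at this; exact this
    -- hence `|t| ≥ 2^(k'+p-1)` and `ulp t ≥ 2^k'`
    have hsplit : (2 : ℚ) ^ (k' + p - 1) = (2 : ℚ) ^ (p - 1 : ℕ) * (2 : ℚ) ^ k' := by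
      rw [← zpow_natCast, ← zpow_add₀ (by norm_num : (2 : ℚ) ≠ 0)]
      congr 1; push_cast [Nat.cast_sub (by omega : 1 ≤ p)]; ring
    have hgabs : ((2 : ℚ) ^ (p - 1 : ℕ) + 1) * (2 : ℚ) ^ k' ≤ |g| := by
      rw [hr, abs_mul, abs_of_pos h2k]; exact mul_le_mul_of_nonneg_right hr1' h2k.le
    have htabs : (2 : ℚ) ^ (k' + p - 1) ≤ |t| := by
      have h1 : |g| - |t - g| ≤ |t| := by
        have := abs_sub_abs_le_abs_sub g t; rw [abs_sub_comm] at this; linarith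
      rw [hsplit]; nlinarith
    have := two_zpow_le_ulp_of_le_abs (p := p) (emin := emin) (k' + p - 1) htabs
    rw [show k' + (p : ℤ) - 1 - p + 1 = k' by ring] at this
    rwa [hk']
  · -- `k' = emin`: every ulp is at least `2^emin`
    rw [hk', ← heq]; exact two_zpow_emin_le_ulp t

/-- ABSORPTION: under any round-to-nearest, a full-odd float `g` absorbs every `t` with
`|t − g| < ulp(g)/2`: `fl t = g`. [cite: BoldoEtAl2023, §2.1 (RN, ulp)] -/
theorem fl_eq_of_fullOdd (hp : 2 ≤ p) (hfl : IsRoundNearest p emin fl) {g t : ℚ}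
    (hg : IsFloat p emin g) {k : ℤ} (hk : ulp p emin g = (2 : ℚ) ^ k)
    (hodd : ¬ OnGrid (k + 1) g) (ht : |t - g| < (2 : ℚ) ^ k / 2) : fl t = g := by
  have hulp := ulp_le_ulp_of_fullOdd hp hg hk hodd ht
  rw [hk] at hulp
  exact fl_eq_of_abs_sub_lt_half_ulp (by omega) hfl hg (by linarith)

/-- ABSORPTION, FAST-TWO-SUM form: for a full-odd float `g` and a float `Q` with `|Q| < ulp(g)/2`
the step FAST-TWO-SUM(g, Q) is INERT: it returns `(g, Q)`. [cite: Shewchuk1997, Thm 6 / §2.7] -/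
theorem fastTwoSum_eq_of_fullOdd (hp : 2 ≤ p) (hfl : IsRoundNearest p emin fl) {g Q : ℚ}
    (hg : IsFloat p emin g) (hg0 : g ≠ 0) (hQ : IsFloat p emin Q) {k : ℤ}
    (hk : ulp p emin g = (2 : ℚ) ^ k) (hodd : ¬ OnGrid (k + 1) g)
    (hQk : |Q| < (2 : ℚ) ^ k / 2) : fastTwoSum fl g Q = (g, Q) := by
  have hx : fl (g + Q) = g := fl_eq_of_fullOdd hp hfl hg hk hodd (by simpa using hQk)
  have hQg : |Q| ≤ |g| := by
    have h1 : (2 : ℚ) ^ k ≤ |g| := by rw [← hk]; exact ulp_le_abs_of_isFloat hg hg0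
    have h2 : (0 : ℚ) < (2 : ℚ) ^ k := zpow_pos (by norm_num) k
    linarith
  have hex := fastTwoSum_exact (by omega) hfl hg hQ hQg
  have h1 : (fastTwoSum fl g Q).1 = g := hex.1.trans hx
  have h2 : (fastTwoSum fl g Q).2 = Q := by rw [hex.2.2.1, hx]; ring
  exact Prod.ext h1 h2

end Summit.Ventures.CertifiedArithmetic.Expansions
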